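import Summits.BirchSwinnertonDyer.BirchSwinnertonDyer.Theorems.EdixhovenFibreFiveSevenTwistDegreeStepFiveSevenSupersingularCellFiveIV
import Summits.BirchSwinnertonDyer.Rank1Residual.Additive.GordTwistMinimalModel
import Literature.NumberTheory.PAdicHodge.DeRhamEllipticAscent
import Literature.NumberTheory.EllipticCurves.IrreducibleModPQuadraticTwistProofs
import Literature.NumberTheory.EllipticCurves.QuadraticTwistPadicReduction
import Literature.NumberTheory.EllipticCurves.GlobalMinimalModelProofs
import HarnessLib

/-!
# Crux TDS57 `TwistDegreeStepFiveSeven` (stmt-BirchSwinnertonDyer-22227): the last cell `(5; II)` by the TWIST — de Rham input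
# DISCHARGED on the whole locus of TDS57; the step off the KP sub-residue GRANTED {P1-bar, hT₂ / [REC-tower], modularity} only

Cell `pub/bsd-wall`, seat `bsd-line-edix-p1` g18 (LEAD of line `kato_lever`; `--supports` 22227 as a helper). TOOL theorems only
(no definition, no named fact, no `sorry`); nothing is closed; BSD is not proved by any of this.

WHAT. Sequel of `…OffKPOfReciprocityLaw` (every cell at `7`, and `(5; III)`) and `…SupersingularCellFiveIV` (`(5; IV)`). The remaining
cell `(5; II)` (`ord₅ Δ_min = 2`, `e = 6 = r₄ + (p − 1)`: outside the (N1′) inequality of the explicit-model capstone) is handled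
WITHOUT a good model of `V`: the `5`-twist `W♭ = C • V^{(5)}` of TDS57's own statement is a starred curve of type IV*
(`padicValRat_u_eq_zero_and_padicValInt_eq_of_twist_pStar`: `ord₅ Δ_min(W♭) = 2 + 6 = 8`; `addv_of_twist_pStar`; `Irr` and «no `Iₙ*`»
pass to the twist), hence de Rham at `ℚ_v` by the K★ theorem `isDeRham_supersingularCells_of_explicitCapstone` (+ `explicitCapstone_holds`);
and `V ≅ W♭` over `K' = ℚ(√5)`, so de Rham-ness TRANSPORTS: ascent `ℚ_v → K'_{v'}` for `W♭`
(`isDeRham_restrictedRationalTateRep_baseChange_above_rat_of_isDeRham`, `Literature/…/DeRhamEllipticAscent.lean`), the `K'`-isomorphism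
`(C_{K'} · C₁ · C₂) • V_{K'} = W♭_{K'}` (`exists_variableChange_quadraticTwist_one/_mul_sq`, `map_quadraticTwist`), and descent
`K'_{v'} → ℚ_v` for `V` (`isDeRham_restrictedRationalTateRep_adicCompletion_rat_of_isDeRham_isogenous_above`).

* `isDeRham_adicCompletion_rat_of_twist_five` — transport of de Rham-ness at `ℚ_v` from `W♭ = C • V^{(5)}` to `V` (any elliptic `V`, `W♭`);
* ★ `isDeRham_adicCompletion_rat_five_of_padicValInt_eq_two` — `V_pV|_{Γ_{ℚ_v}}` is de Rham on the cell `(5; II)`;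
* ★★ `twistDegreeStep57_of_sl2NeronValuesBar_of_noTorsion_five` / `…_of_noTorsion` — the conclusion of TDS57 at `(p, V, W♭)` off the
  Kosters–Pannekoek sub-residue for EVERY `p ∈ {5, 7}` and every cell, GRANTED ONLY {P1-bar, hT₂, modularity}; and
  ★★ `twistDegreeStep57_of_reciprocityLaw_of_sl2NeronValuesBar_of_noTorsion` with Kato's reciprocity law [REC-tower] in place of hT₂.
So on TDS57's locus the de Rham input (formerly Fontaine's cite-only `isDeRham_restrictedRationalTateRep`) is a THEOREM; what TDS57 rests
on off-KP is {P1-bar, [REC-tower], modularity} — the same two printed inputs as K★ (22226) — plus the KP sub-residue road (`…OfKP`).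
CONDITIONAL; the item stays OPEN.

References: [Kato2004Asterisque] Thm. 6.6 (1), (8.1.3), Thm. 9.7; [Kato1993LNM1553] Ch. II Thm. 1.4.1 (4); [KostersPannekoek2017] Thm. 1,
Cor. 2; [SilvermanAEC2009] X.5 Cor. 5.4, VII.5.5; [SilvermanATAEC1994] IV Table 4.1; [BrinonConrad2009] Prop. 6.3.8;
[Fontaine1982FormesDifferentielles] §5.
-/

set_option autoImplicit false
-- the Theorems namespace of a single-conjunct summit repeats the summit name by design (D-0017)
set_option linter.dupNamespace false

noncomputable section

open scoped Classical MatrixGroups NumberField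

open Polynomial WeierstrassCurve NumberField IsDedekindDomain Field ValuativeRel
  Literature.NumberTheory.EllipticCurves Literature.NumberTheory.EllipticCurves.ModularForms
  Literature.NumberTheory.EllipticCurves.Rank1Residual Literature.NumberTheory.EllipticCurves.Kato2004
  Literature.NumberTheory.DiophantineGeometry Rat.HeightOneSpectrum
  Literature.NumberTheory.PAdicHodge Literature.NumberTheory.GaloisRepresentations
  Literature.NumberTheory.GaloisRepresentations.IsNonarchimedeanLocalField
  Summit.BirchSwinnertonDyer.Rank1Residual Summit.BirchSwinnertonDyer.Rank1Residual.Additive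
  Summit.BirchSwinnertonDyer.BirchSwinnertonDyer.Theorems
  Summit.BirchSwinnertonDyer.BirchSwinnertonDyer.Theorems.KatoAssemblySocketAt
  Summit.BirchSwinnertonDyer.BirchSwinnertonDyer.Theorems.TwistDegreeStepFiveSevenOfSL2NeronValues
  Summit.BirchSwinnertonDyer.BirchSwinnertonDyer.Theorems.TwistDegreeStepFiveSeven
  Summit.BirchSwinnertonDyer.BirchSwinnertonDyer.Theorems.TwistDegreeStepFiveSevenOffKPOfReciprocityLaw
  Summit.BirchSwinnertonDyer.BirchSwinnertonDyer.Theorems.TwistDegreeStepFiveSevenSupersingularCellFiveIV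
  Summit.BirchSwinnertonDyer.BirchSwinnertonDyer.Theorems.StarredOptimalManinUnitFiveSevenCellsOfSL2NeronValues
  Summit.BirchSwinnertonDyer.BirchSwinnertonDyer.Theorems.StarredOptimalManinUnitFiveSevenSupersingularCellsExplicit
  Summit.BirchSwinnertonDyer.BirchSwinnertonDyer.Theorems.StarredOptimalManinUnitFiveSevenSupersingularCellsDeRhamHolds
  Summit.BirchSwinnertonDyer.BirchSwinnertonDyer.Theorems.StarredOptimalManinUnitFiveSevenSupersingularCellsModels
  CongruenceSubgroup Complex

namespace Summit.BirchSwinnertonDyer.BirchSwinnertonDyer.Theorems.TwistDegreeStepFiveSevenCellFiveII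

variable {p : ℕ} [hp : Fact p.Prime]

/-! ### Transport of de Rham-ness along the `5`-twist -/

/-- **De Rham-ness at `ℚ_v` transports from `W♭ = C • V^{(5)}` to `V`.** Over `K' = ℚ(√5)` the two curves are isomorphic
(`W♭_{K'} = (C_{K'} · C₁ · C₂) • V_{K'}`: `map_quadraticTwist`, `exists_variableChange_quadraticTwist_mul_sq` with `e = √5`,
`exists_variableChange_quadraticTwist_one`); de Rham-ness of `W♭` ascends `ℚ_v → K'_{v'}` and that of `V` descends `K'_{v'} → ℚ_v`.
[cite: SilvermanAEC2009, X.5 Cor. 5.4] [cite: BrinonConrad2009, Prop. 6.3.8] -/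
theorem isDeRham_adicCompletion_rat_of_twist_five
    (V Wf : WeierstrassCurve ℚ) [V.IsElliptic] [Wf.IsElliptic] (hp5 : p = 5) (C : VariableChange ℚ)
    (hC : C • V.quadraticTwist ((-1 : ℚ) ^ (p / 2) * p) = Wf)
    (hWf : ∀ (v : HeightOneSpectrum (𝓞 ℚ)), ((p : ℕ) : 𝓞 ℚ) ∈ v.asIdeal →
      ∀ [CharZero (v.adicCompletion ℚ)] [Fact (¬ IsUnit (p : integerC (v.adicCompletion ℚ)))]
        [IsAdicComplete (Ideal.span {(p : integerC (v.adicCompletion ℚ))}) (integerC (v.adicCompletion ℚ))]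
        (hp' : valuation (v.adicCompletion ℚ) p < 1) [Algebra ℚ_[p] (v.adicCompletion ℚ)],
        GaloisRep.IsDeRham (bdRPeriodRingData (F := v.adicCompletion ℚ) (p := p) hp')
          (restrictedRationalTateRep Wf (v.adicCompletion ℚ) p))
    (v : HeightOneSpectrum (𝓞 ℚ)) (hpv : ((p : ℕ) : 𝓞 ℚ) ∈ v.asIdeal)
    [CharZero (v.adicCompletion ℚ)] [Fact (¬ IsUnit (p : integerC (v.adicCompletion ℚ)))]
    [IsAdicComplete (Ideal.span {(p : integerC (v.adicCompletion ℚ))}) (integerC (v.adicCompletion ℚ))]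
    (hp' : valuation (v.adicCompletion ℚ) p < 1) [Algebra ℚ_[p] (v.adicCompletion ℚ)] :
    GaloisRep.IsDeRham (bdRPeriodRingData (F := v.adicCompletion ℚ) (p := p) hp')
      (restrictedRationalTateRep V (v.adicCompletion ℚ) p) := by
  subst hp5
  have hC5 : C • V.quadraticTwist (5 : ℚ) = Wf := by norm_num at hC; exact hC
  obtain ⟨K', _, _, α, v', hαe, hv'⟩ := exists_numberField_pow_eq_prime (e := 2) (by norm_num) hp.out
  have hα5 : α ^ 2 = (5 : K') := by rw [hαe]; norm_num
  have hα0 : α ≠ 0 := by intro h0; rw [h0] at hα5; norm_num at hα5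
  haveI : NeZero (2 : K') := ⟨two_ne_zero⟩
  obtain ⟨C₁, hC₁⟩ := (V.baseChange K').exists_variableChange_quadraticTwist_mul_sq 1 α hα0
  obtain ⟨C₂, hC₂⟩ := (V.baseChange K').exists_variableChange_quadraticTwist_one
  -- `W♭_{K'} = C_{K'} • V_{K'}^{(α²)}`
  have hWfK : Wf.baseChange K' = C.baseChange K' • (V.baseChange K').quadraticTwist (1 * α ^ 2) := by
    rw [← hC5, baseChange_smul_eq, one_mul, hα5]
    congr 1
    rw [WeierstrassCurve.baseChange, map_quadraticTwist, map_ofNat]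
    rfl
  have h : (C.baseChange K' * C₁ * C₂) • V.baseChange K' = Wf.baseChange K' := by
    rw [mul_smul, mul_smul, hC₂, hC₁, hWfK]
  have hiso : IsIsogenous (V.baseChange K') (Wf.baseChange K') := isIsogenous_of_smul_eq h
  refine isDeRham_restrictedRationalTateRep_adicCompletion_rat_of_isDeRham_isogenous_above V v' hv' (Wf.baseChange K') hiso ?_
    v hpv hp'
  intro _ _ _ hpF _
  exact isDeRham_restrictedRationalTateRep_baseChange_above_rat_of_isDeRham Wf v' hv' v hpv hp' (hWf v hpv hp') hpF

/-! ### The cell `(5; II)` -/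

/-- ★ **`V_pV|_{Γ_{ℚ_v}}` is de Rham for an additive fibre of Kodaira type II at `5`** (`V` globally minimal, `E[5]` irreducible, no `Iₙ*`,
`ord₅ Δ_min(V) = 2`, `W♭` a globally minimal model of `V ⊗ χ₅`): `W♭` is additive at `5` (`addv_of_twist_pStar`), potentially good, of
type IV* (`ord₅ Δ_min(W♭) = 8`, `padicValRat_u_eq_zero_and_padicValInt_eq_of_twist_pStar`), without `Iₙ*` (`forall_ne_Istar_of_padicValRat_j_nonneg`)
and with `E[5]` irreducible (`hasIrreducibleModPGaloisRep_iff_of_smul_eq_quadraticTwist`), hence de Rham by the starred explicit-model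
theorem `isDeRham_supersingularCells_of_explicitCapstone`; transport by `isDeRham_adicCompletion_rat_of_twist_five`.
[cite: SilvermanATAEC1994, IV Table 4.1] [cite: SilvermanAEC2009, X.5 Cor. 5.4 and VII.5.5] [cite: Fontaine1982FormesDifferentielles, §5] -/
theorem isDeRham_adicCompletion_rat_five_of_padicValInt_eq_two
    (V Wf : WeierstrassCurve ℚ) [V.IsElliptic] [V.IsGloballyMinimal] [Wf.IsElliptic] [Wf.IsGloballyMinimal]
    (C : VariableChange ℚ) (hp5 : p = 5) (hadd : Addv V p) (hirr : Irr V p)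
    (hK : ∀ (v : HeightOneSpectrum ℤ) (n : ℕ), natGenerator v = p → V.kodairaSymbolAt v ≠ KodairaSymbol.Istar n)
    (h2 : padicValInt p V.minimalDiscriminantInt = 2)
    (hC : C • V.quadraticTwist ((-1 : ℚ) ^ (p / 2) * p) = Wf)
    (v : HeightOneSpectrum (𝓞 ℚ)) (hpv : ((p : ℕ) : 𝓞 ℚ) ∈ v.asIdeal)
    [CharZero (v.adicCompletion ℚ)] [Fact (¬ IsUnit (p : integerC (v.adicCompletion ℚ)))]
    [IsAdicComplete (Ideal.span {(p : integerC (v.adicCompletion ℚ))}) (integerC (v.adicCompletion ℚ))]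
    (hp' : valuation (v.adicCompletion ℚ) p < 1) [Algebra ℚ_[p] (v.adicCompletion ℚ)] :
    GaloisRep.IsDeRham (bdRPeriodRingData (F := v.adicCompletion ℚ) (p := p) hp')
      (restrictedRationalTateRep V (v.adicCompletion ℚ) p) := by
  have hp2 : p ≠ 2 := by omega
  have hj : 0 ≤ padicValRat p V.j :=
    MemberManinUnitFiveSevenGlue.padicValRat_j_nonneg_of_forall_ne_Istar V hp2 hadd hK
  have hlt6 : padicValInt p V.minimalDiscriminantInt < 6 := by omega
  obtain ⟨haddf, hjf, -⟩ := addv_of_twist_pStar p hp2 V Wf hj hlt6 C hC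
  obtain ⟨-, h8⟩ := padicValRat_u_eq_zero_and_padicValInt_eq_of_twist_pStar p hp2 V Wf hlt6 C hC
  rw [h2] at h8
  have hKf := MemberManinUnitFiveSevenGlue.forall_ne_Istar_of_padicValRat_j_nonneg Wf (by omega) haddf hjf (by omega)
  have hd : ((-1 : ℚ) ^ (p / 2) * p) ≠ 0 :=
    mul_ne_zero (pow_ne_zero _ (by norm_num)) (Nat.cast_ne_zero.2 hp.out.ne_zero)
  have hC' : C⁻¹ • Wf = V.quadraticTwist ((-1 : ℚ) ^ (p / 2) * p) := by rw [← hC, inv_smul_smul]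
  have hirrf : Irr Wf p := (hasIrreducibleModPGaloisRep_iff_of_smul_eq_quadraticTwist V Wf hd hC' p).2 hirr
  refine isDeRham_adicCompletion_rat_of_twist_five V Wf hp5 C hC ?_ v hpv hp'
  intro w hpw _ _ _ hpw' _
  exact isDeRham_supersingularCells_of_explicitCapstone explicitCapstone_holds Wf p (Or.inl hp5) haddf hirrf hKf (by omega)
    (by omega) w hpw hpw'

/-- ★ **Cell `(5; II)` of TDS57 off the KP sub-residue GRANTED {P1-bar, hT₂, modularity}.**
[cite: Kato2004Asterisque, (8.1.3) (p. 180), Thm. 9.7 (p. 189)] [cite: KostersPannekoek2017, Thm. 1 and Cor. 2] [cite: SilvermanAEC2009, X.5 Cor. 5.4] -/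
theorem twistDegreeStep57_of_sl2NeronValuesBar_of_noTorsion_five_of_padicValInt_eq_two
    (hT₂ : exists_smul_range_expStarCoord_tower_iff_trace_log) (hP1 : exists_member_sl2ZetaElement_neron_values_bar)
    (hnf : exists_isNewformOf)
    (V : WeierstrassCurve ℚ) [V.IsElliptic] [V.IsGloballyMinimal] [NeZero (V.conductorNorm ℤ)]
    (Wf : WeierstrassCurve ℚ) [Wf.IsElliptic] [Wf.IsGloballyMinimal] [NeZero (Wf.conductorNorm ℤ)]
    (C : VariableChange ℚ) (hp5 : p = 5) (hadd : Addv V p) (hirr : Irr V p)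
    (hK : ∀ (v : HeightOneSpectrum ℤ) (n : ℕ), natGenerator v = p → V.kodairaSymbolAt v ≠ KodairaSymbol.Istar n)
    (h2 : padicValInt p V.minimalDiscriminantInt = 2)
    (hC : C • V.quadraticTwist ((-1 : ℚ) ^ (p / 2) * p) = Wf)
    (hPT : ∀ (W' : WeierstrassCurve ℚ) [W'.IsElliptic] [W'.IsGloballyMinimal], IsIsogenous V W' →
      ∀ P : (W'.baseChange ℚ_[p]).toAffine.Point, p • P = 0 → P = 0) :
    ∃ D : ModularParametrizationData V (V.conductorNorm ℤ),
      ∀ Df : ModularParametrizationData Wf (Wf.conductorNorm ℤ),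
        padicValNat p D.modularDegree < padicValNat p Df.modularDegree :=
  twistDegreeStep57_of_sl2NeronValuesBar_of_noTorsion_of_isDeRhamAt hT₂ hP1 hnf V Wf C (Or.inl hp5) hadd hirr hK (by omega) hC hPT
    (fun v hpv _ _ _ hp' _ ↦ isDeRham_adicCompletion_rat_five_of_padicValInt_eq_two V Wf C hp5 hadd hirr hK h2 hC v hpv hp')

/-- ★★ **At `p = 5`, every cell, off the KP sub-residue, GRANTED {P1-bar, hT₂, modularity}** — NO de Rham hypothesis: `ord₅ Δ_min = 2` by the
twist, `3` (G)-ordinary, `4` by the explicit model (`…SupersingularCellFiveIV`); `ord₅ Δ_min ≥ 2` at an additive prime.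
[cite: Kato2004Asterisque, (8.1.3) (p. 180), Thm. 9.7 (p. 189)] [cite: DokchitserDokchitser2015LocalInvariants, Thm. 3.2]
[cite: Fontaine1982FormesDifferentielles, §5] -/
theorem twistDegreeStep57_of_sl2NeronValuesBar_of_noTorsion_five
    (hT₂ : exists_smul_range_expStarCoord_tower_iff_trace_log) (hP1 : exists_member_sl2ZetaElement_neron_values_bar)
    (hnf : exists_isNewformOf)
    (V : WeierstrassCurve ℚ) [V.IsElliptic] [V.IsGloballyMinimal] [NeZero (V.conductorNorm ℤ)]
    (Wf : WeierstrassCurve ℚ) [Wf.IsElliptic] [Wf.IsGloballyMinimal] [NeZero (Wf.conductorNorm ℤ)]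
    (C : VariableChange ℚ) (hp5 : p = 5) (hadd : Addv V p) (hirr : Irr V p)
    (hK : ∀ (v : HeightOneSpectrum ℤ) (n : ℕ), natGenerator v = p → V.kodairaSymbolAt v ≠ KodairaSymbol.Istar n)
    (hV4 : padicValInt p V.minimalDiscriminantInt ≤ 4)
    (hC : C • V.quadraticTwist ((-1 : ℚ) ^ (p / 2) * p) = Wf)
    (hPT : ∀ (W' : WeierstrassCurve ℚ) [W'.IsElliptic] [W'.IsGloballyMinimal], IsIsogenous V W' →
      ∀ P : (W'.baseChange ℚ_[p]).toAffine.Point, p • P = 0 → P = 0) :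
    ∃ D : ModularParametrizationData V (V.conductorNorm ℤ),
      ∀ Df : ModularParametrizationData Wf (Wf.conductorNorm ℤ),
        padicValNat p D.modularDegree < padicValNat p Df.modularDegree := by
  have h2le : 2 ≤ padicValInt p V.minimalDiscriminantInt :=
    MemberManinUnitFiveSevenGlue.two_le_padicValInt_minimalDiscriminantInt_of_addv V (by omega) hadd
  by_cases h2 : padicValInt p V.minimalDiscriminantInt = 2
  · exact twistDegreeStep57_of_sl2NeronValuesBar_of_noTorsion_five_of_padicValInt_eq_two hT₂ hP1 hnf V Wf C hp5 hadd hirr hK h2 hC hPT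
  · exact twistDegreeStep57_of_sl2NeronValuesBar_of_noTorsion_five_of_three_le hT₂ hP1 hnf V Wf C hp5 hadd hirr hK (by omega) hV4
      hC hPT

/-- ★★ **TDS57's conclusion at `(p, V, W♭)` off the Kosters–Pannekoek sub-residue, `p ∈ {5, 7}`, EVERY cell, GRANTED ONLY
{P1-bar, hT₂, modularity}** — the de Rham input of `twistDegreeStep57_of_sl2NeronValues_of_noTorsion_of_isDeRhamAt` is a THEOREM on the
whole locus of TDS57 (`p = 7`: `…_of_noTorsion_seven`; `p = 5`: `…_of_noTorsion_five`). CONDITIONAL on the two cite-only facts; nothing closed.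
[cite: Kato2004Asterisque, Thm. 6.6 (1) (p. 163), (8.1.3) (p. 180), Thm. 9.7 (p. 189)] [cite: Kato1993LNM1553, Ch. II Thm. 1.4.1 (3)–(4)]
[cite: KostersPannekoek2017, Thm. 1 and Cor. 2] -/
theorem twistDegreeStep57_of_sl2NeronValuesBar_of_noTorsion
    (hT₂ : exists_smul_range_expStarCoord_tower_iff_trace_log) (hP1 : exists_member_sl2ZetaElement_neron_values_bar)
    (hnf : exists_isNewformOf)
    (V : WeierstrassCurve ℚ) [V.IsElliptic] [V.IsGloballyMinimal] [NeZero (V.conductorNorm ℤ)]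
    (Wf : WeierstrassCurve ℚ) [Wf.IsElliptic] [Wf.IsGloballyMinimal] [NeZero (Wf.conductorNorm ℤ)]
    (C : VariableChange ℚ) (hp57 : p = 5 ∨ p = 7) (hadd : Addv V p) (hirr : Irr V p)
    (hK : ∀ (v : HeightOneSpectrum ℤ) (n : ℕ), natGenerator v = p → V.kodairaSymbolAt v ≠ KodairaSymbol.Istar n)
    (hV4 : padicValInt p V.minimalDiscriminantInt ≤ 4)
    (hC : C • V.quadraticTwist ((-1 : ℚ) ^ (p / 2) * p) = Wf)
    (hPT : ∀ (W' : WeierstrassCurve ℚ) [W'.IsElliptic] [W'.IsGloballyMinimal], IsIsogenous V W' →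
      ∀ P : (W'.baseChange ℚ_[p]).toAffine.Point, p • P = 0 → P = 0) :
    ∃ D : ModularParametrizationData V (V.conductorNorm ℤ),
      ∀ Df : ModularParametrizationData Wf (Wf.conductorNorm ℤ),
        padicValNat p D.modularDegree < padicValNat p Df.modularDegree := by
  rcases hp57 with h5 | h7
  · exact twistDegreeStep57_of_sl2NeronValuesBar_of_noTorsion_five hT₂ hP1 hnf V Wf C h5 hadd hirr hK hV4 hC hPT
  · exact twistDegreeStep57_of_sl2NeronValuesBar_of_noTorsion_seven hT₂ hP1 hnf V Wf C h7 hadd hirr hK hV4 hC hPT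

/-- ★★ **The same GRANTED {[REC-tower], P1-bar, modularity}** — hT₂ := `exists_smul_range_expStarCoord_tower_iff_trace_log_of_reciprocityLaw hrec`
(p700964): off the KP sub-residue, TDS57 rests on Kato's explicit reciprocity law for `V_pE` and Kato's `SL₂(ℤ)` zeta values — the two
printed inputs of K★ (22226). [cite: Kato1993LNM1553, Ch. II Thm. 1.4.1 (4)] [cite: Kato2004Asterisque, (8.1.3) (p. 180), Thm. 9.7 (p. 189)] -/
theorem twistDegreeStep57_of_reciprocityLaw_of_sl2NeronValuesBar_of_noTorsion
    (hrec : tatePairingPoint_eq_trace_expStar_log_tower) (hP1 : exists_member_sl2ZetaElement_neron_values_bar)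
    (hnf : exists_isNewformOf)
    (V : WeierstrassCurve ℚ) [V.IsElliptic] [V.IsGloballyMinimal] [NeZero (V.conductorNorm ℤ)]
    (Wf : WeierstrassCurve ℚ) [Wf.IsElliptic] [Wf.IsGloballyMinimal] [NeZero (Wf.conductorNorm ℤ)]
    (C : VariableChange ℚ) (hp57 : p = 5 ∨ p = 7) (hadd : Addv V p) (hirr : Irr V p)
    (hK : ∀ (v : HeightOneSpectrum ℤ) (n : ℕ), natGenerator v = p → V.kodairaSymbolAt v ≠ KodairaSymbol.Istar n)
    (hV4 : padicValInt p V.minimalDiscriminantInt ≤ 4)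
    (hC : C • V.quadraticTwist ((-1 : ℚ) ^ (p / 2) * p) = Wf)
    (hPT : ∀ (W' : WeierstrassCurve ℚ) [W'.IsElliptic] [W'.IsGloballyMinimal], IsIsogenous V W' →
      ∀ P : (W'.baseChange ℚ_[p]).toAffine.Point, p • P = 0 → P = 0) :
    ∃ D : ModularParametrizationData V (V.conductorNorm ℤ),
      ∀ Df : ModularParametrizationData Wf (Wf.conductorNorm ℤ),
        padicValNat p D.modularDegree < padicValNat p Df.modularDegree :=
  twistDegreeStep57_of_sl2NeronValuesBar_of_noTorsion (exists_smul_range_expStarCoord_tower_iff_trace_log_of_reciprocityLaw hrec)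
    hP1 hnf V Wf C hp57 hadd hirr hK hV4 hC hPT

end Summit.BirchSwinnertonDyer.BirchSwinnertonDyer.Theorems.TwistDegreeStepFiveSevenCellFiveII

end
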